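import Summits.ResolutionOfSingularities.ResolutionOfSingularities.Theorems.WeightedInvariantLocalWeightedDropTrackCSurfaceGermsWon

/-!
# TRACK C re-run on the CORRECTED Cossart–Jannsen–Saito sequence (F-32bR): every singular surface germ is won

[OURS · L1 W4.3 · chain w43, engine crux `LocalWeightedDrop` stmt-ResolutionOfSingularities-8899; res-type-088 for
stub worker 4's Track C] NOT a statement of any manuscript; the game (`CobordantGame.Won`) is the programme's own.

Track C (`…TrackCSurfaceGermsWon`, `TrackC.surfaceGermsWon_of_CJSSequence`) closes the `N = 3` layer of the engine
MODULO the named fact `CossartJannsenSaito2020EmbeddedSequence` (F-32b). That fact was SUPERSEDED on 2026-08-27: as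
typed — with the Introduction's clause «`D_j ⊂ (X_j)_sing`» at EVERY step (`IsBPermissibleSequence.blowup`, `hsing`)
AND the end clause «`X₁` transversal with `B₁`» — it is refutable (cusp / `A₂` witness; correction record in
`Literature/AlgebraicGeometry/Resolution/EmbeddedResolutionExcellentSurfacesSequence.lean`), so a theorem taking
`(hCJS : CossartJannsenSaito2020EmbeddedSequence)` is closed modulo a false premise. The corrected fact
`CossartJannsenSaito2020EmbeddedSequenceB` (F-32bR; per-step clause of CJS Thm. 6.9 (a) / Def. 6.1 (2): every centre
point is a singular point of `X_j` OR lies on the boundary `B_j`) is the one consumers cite.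

This file re-runs Track C's induction along `IsBPermissibleSequenceB`. The ONLY use Track C makes of the per-step
singularity clause is `TrackC.centre_ne_bot` (the centre is a non-zero ideal sheaf, so the blow-up of the integral
`Z_j` is again integral, `IsBlowup.isIntegral`). Under the weaker clause «singular OR on `B_j`» the centre is still
non-zero, because the generic point of `Z_j` never lies on the iterated boundary: `B₀` is a proper closed subset and
`B_{j+1} = τ⁻¹(B_j ∪ V(C_j))` stays proper closed (the blow-up is an isomorphism over the non-empty open
`Z_j ∖ (B_j ∪ V(C_j))`, `IsBlowup.isIso_morphismRestrict`). Everything else — BASE `won_of_wonAt_id`, STEP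
`wonAt_of_wonAt_blowup`, END `wonAt_end`, frames and charts — is imported unchanged from stub worker 4's files.

* `genericPoint_not_mem_of_isClosed`, `genericPoint_not_mem_support` — the generic point of an integral scheme misses
  every proper closed subset and the support of every non-zero ideal sheaf.
* `centre_ne_bot_B` — a centre of an `IsBPermissibleSequenceB` step is `≠ ⊥` once the generic point is off `B_j`.
* `forwardB` — along `IsBPermissibleSequenceB` from an integral locally Noetherian `Z` with `B` proper closed:
  `Z'` integral and locally Noetherian, injective stalk maps, `B'` proper closed.
* `isClosed_of_seqB`, `totalGerm_ne_zero_B`, `wonAt_transformerB`, `exists_sequence_zeroLocusB` — the F-32bR forms of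
  the corresponding Track C lemmas.
* `surfaceGermsWon_of_CJSSequenceB` — **TRACK C CLOSED MODULO F-32bR**: the same conclusion as
  `surfaceGermsWon_of_CJSSequence`, from `(hCJS : CossartJannsenSaito2020EmbeddedSequenceB.{0})`.
-/

noncomputable section

open CategoryTheory CategoryTheory.Limits AlgebraicGeometry TopologicalSpace IsLocalRing
open Literature.AlgebraicGeometry.Resolution
open Scheme.IdealSheafData

set_option linter.dupNamespace false -- mandated namespace of this single-conjunct summit

namespace Summit.ResolutionOfSingularities.ResolutionOfSingularities.Theorems.TrackC

/-! ## The generic point misses proper closed subsets and centres -/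

/-- The generic point of an integral scheme lies in no proper closed subset. [OURS · folklore] -/
theorem genericPoint_not_mem_of_isClosed {Z' : Scheme.{0}} [IsIntegral Z'] {B' : Set Z'}
    (hB : IsClosed B') (hne : B' ≠ Set.univ) : genericPoint Z' ∉ B' := by
  intro hξ
  exact hne (Set.eq_univ_of_forall fun y => (genericPoint_specializes y).mem_closed hB hξ)

/-- The generic point of an integral scheme lies outside the support of every non-zero ideal sheaf (the stalk
there is an ideal of the function field, and it is non-zero). [OURS · folklore] -/
theorem genericPoint_not_mem_support {Z' : Scheme.{0}} [IsIntegral Z'] {C : Z'.IdealSheafData}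
    (hC : C ≠ ⊥) : genericPoint Z' ∉ (C.support : Set Z') := by
  intro hξ
  have hle := (mem_support_iff_stalkIdeal_le C (genericPoint Z')).mp hξ
  have hbot : maximalIdeal (Z'.presheaf.stalk (genericPoint Z')) = ⊥ :=
    (IsLocalRing.isField_iff_maximalIdeal_eq).mp (Field.toIsField Z'.functionField)
  rw [hbot] at hle
  exact stalkIdeal_ne_bot_of_ne_bot hC (genericPoint Z') (le_bot_iff.mp hle)

/-- **A centre of a step of a corrected `𝓑`-permissible sequence of an integral scheme is a non-zero ideal
sheaf**, provided the generic point is off the boundary: at the generic point the strict transform's ideal would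
vanish and the local ring — a field — would be regular, against «singular OR on `B_j`». [OURS · folklore] -/
theorem centre_ne_bot_B {Z' : Scheme.{0}} [IsIntegral Z'] {X' B' : Set Z'} (C : Z'.IdealSheafData)
    (hsub : vanishingIdeal ⟨closure X', isClosed_closure⟩ ≤ C)
    (hBsing : ∀ x ∈ (C.support : Set Z'), ¬ IsRegularLocalRing
      ((Z'.presheaf.stalk x) ⧸ stalkIdeal (vanishingIdeal ⟨closure X', isClosed_closure⟩) x) ∨ x ∈ B')
    (hξB : genericPoint Z' ∉ B') : C ≠ ⊥ := by
  intro hC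
  have hξ : genericPoint Z' ∈ (C.support : Set Z') := by
    rw [hC, Scheme.IdealSheafData.support_bot]; trivial
  rcases hBsing _ hξ with h | h
  · apply h
    have h2 : stalkIdeal (vanishingIdeal ⟨closure X', isClosed_closure⟩) (genericPoint Z') = ⊥ :=
      le_bot_iff.mp ((stalkIdeal_mono hsub _).trans (by rw [hC, stalkIdeal_bot]))
    rw [h2]
    haveI : IsRegularLocalRing (Z'.presheaf.stalk (genericPoint Z')) :=
      (inferInstance : IsRegularLocalRing Z'.functionField)
    exact IsRegularLocalRing.of_ringEquiv (RingEquiv.quotientBot _).symm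
  · exact hξB h

/-! ## FORWARD invariants along the corrected sequence -/

variable {Z : Scheme.{0}} {X B : Set Z}

/-- **FORWARD invariants (F-32bR form).** Along a corrected `𝓑`-permissible sequence starting from an integral
locally Noetherian scheme with a proper closed boundary `B`, the blown-up scheme is integral and locally Noetherian,
all stalk maps of the composite are injective, and the iterated boundary `B'` is again a proper closed subset.
[OURS · folklore] -/
theorem forwardB [IsIntegral Z] [IsLocallyNoetherian Z] (hB : IsClosed B) (hBne : B ≠ Set.univ)
    {Z' : Scheme.{0}} {σ : Z' ⟶ Z} {X' B' : Set Z'} (hseq : IsBPermissibleSequenceB X B σ X' B') :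
    IsIntegral Z' ∧ IsLocallyNoetherian Z' ∧ (∀ z : Z', Function.Injective (σ.stalkMap z).hom) ∧
      IsClosed B' ∧ B' ≠ Set.univ := by
  induction hseq with
  | refl =>
    refine ⟨inferInstance, inferInstance, fun z => ?_, hB, hBne⟩
    rw [Scheme.Hom.stalkMap_id]
    exact fun a b h => h
  | @blowup Z' Z'' σ X' B' h C τ hτ hreg hsub hBsing hperm hnc ih =>
    obtain ⟨hint, hnoeth, hinj, hB'c, hB'ne⟩ := ih
    have hξB : genericPoint Z' ∉ B' := genericPoint_not_mem_of_isClosed hB'c hB'ne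
    have hC : C ≠ ⊥ := centre_ne_bot_B C hsub hBsing hξB
    haveI := hτ.isIntegral hC
    haveI := hτ.isProper
    haveI : IsLocallyNoetherian Z'' := LocallyOfFiniteType.isLocallyNoetherian τ
    refine ⟨inferInstance, inferInstance, fun z => ?_, ?_, ?_⟩
    · rw [Scheme.Hom.stalkMap_comp]
      exact (hτ.stalkMap_injective z).comp (hinj (τ z))
    · exact (hB'c.union C.support.isClosed).preimage τ.continuous
    · -- the blow-up is an isomorphism over the non-empty open `Z' ∖ (B' ∪ V(C))`, which contains the generic
      -- point; its preimage is a point of `Z''` off the new boundary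
      have hξC : genericPoint Z' ∉ (C.support : Set Z') := genericPoint_not_mem_support hC
      let U : Z'.Opens := ⟨(B' ∪ (C.support : Set Z'))ᶜ, (hB'c.union C.support.isClosed).isOpen_compl⟩
      have hU : Disjoint (U : Set Z') C.support :=
        Set.disjoint_left.mpr fun x hx hx' => hx (Or.inr hx')
      haveI : IsIso (τ ∣_ U) := hτ.isIso_morphismRestrict hU
      have hξU : genericPoint Z' ∈ U := fun h => h.elim hξB hξC
      let y : ↥(τ ⁻¹ᵁ U) := (inv (τ ∣_ U)) ⟨genericPoint Z', hξU⟩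
      have hy' : (τ ∣_ U) y = ⟨genericPoint Z', hξU⟩ := by
        change (inv (τ ∣_ U) ≫ τ ∣_ U) ⟨genericPoint Z', hξU⟩ = _
        rw [IsIso.inv_hom_id]
        rfl
      have hy : τ y.1 = genericPoint Z' := by
        rw [← morphismRestrict_base_coe τ U y, hy']
      intro huniv
      have hmem : y.1 ∈ τ ⁻¹' (B' ∪ (C.support : Set Z')) := huniv ▸ Set.mem_univ _
      rw [Set.mem_preimage, hy] at hmem
      exact hmem.elim hξB hξC

/-- Along a corrected `𝓑`-permissible sequence the strict transform of a closed set is closed. [OURS · folklore] -/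
theorem isClosed_of_seqB {Z' : Scheme.{0}} {σ : Z' ⟶ Z} {X' B' : Set Z'}
    (hseq : IsBPermissibleSequenceB X B σ X' B') (hX : IsClosed X) : IsClosed X' := by
  induction hseq with
  | refl => exact hX
  | blowup => exact isClosed_closure

variable {k : Type} [Field k]

/-- **The total transform of `f ≠ 0` is non-zero at every point** of a corrected `𝓑`-permissible sequence over
`Z₀ = Spec k⟦x₀,x₁,x₂⟧` with proper closed starting boundary. [OURS · folklore] -/
theorem totalGerm_ne_zero_B {X B : Set (Spec (.of (MvPowerSeries (Fin 3) k)))} (hB : IsClosed B)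
    (hBne : B ≠ Set.univ) {Z' : Scheme.{0}} {σ : Z' ⟶ Spec (.of (MvPowerSeries (Fin 3) k))} {X' B' : Set Z'}
    (hseq : IsBPermissibleSequenceB X B σ X' B') {f : MvPowerSeries (Fin 3) k} (hf : f ≠ 0) (z : Z') :
    totalGerm σ z f ≠ 0 := by
  haveI : IsDomain (MvPowerSeries (Fin 3) k) := NoZeroDivisors.to_isDomain _
  haveI : IsNoetherianRing (MvPowerSeries (Fin 3) k) := isNoetherianRing_mvPowerSeries (Fin 3) (R := k)
  obtain ⟨-, -, hinj, -, -⟩ := forwardB hB hBne hseq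
  -- the total transform is the image of the germ of `f` under the (injective) stalk map
  have h1 : totalGerm σ z f = (σ.stalkMap z).hom
      (((Spec (.of (MvPowerSeries (Fin 3) k))).presheaf.germ ⊤ (σ z) trivial).hom
        ((Scheme.ΓSpecIso (.of (MvPowerSeries (Fin 3) k))).inv.hom f)) :=
    (Scheme.Hom.germ_stalkMap_apply σ ⊤ z trivial _).symm
  rw [h1, map_ne_zero_iff _ (hinj z)]
  -- the germ of `f ≠ 0` at any point of `Spec` of a domain is non-zero
  letI : Algebra (MvPowerSeries (Fin 3) k) ((Spec (.of (MvPowerSeries (Fin 3) k))).presheaf.stalk (σ z)) :=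
    StructureSheaf.stalkAlgebra (MvPowerSeries (Fin 3) k) (σ z)
  haveI : IsLocalization.AtPrime ((Spec (.of (MvPowerSeries (Fin 3) k))).presheaf.stalk (σ z))
      (σ z).asIdeal := StructureSheaf.IsLocalization.to_stalk (MvPowerSeries (Fin 3) k) (σ z)
  change algebraMap (MvPowerSeries (Fin 3) k) _ f ≠ 0
  intro h0
  exact hf ((IsLocalization.to_map_eq_zero_iff _ (σ z).asIdeal.primeCompl_le_nonZeroDivisors).mp h0)

/-! ## INDUCTION along the corrected sequence and the CJS input -/

/-- **INDUCTION along the corrected sequence.** `WonAt f σ → WonAt f (𝟙 Z₀)` for every corrected `𝓑`-permissible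
sequence `σ : Z' ⟶ Z₀` over `Z₀ = Spec k⟦x₀,x₁,x₂⟧` whose starting boundary is a proper closed subset.
[OURS · folklore] -/
theorem wonAt_transformerB (p : ℕ) (hp : p.Prime) [CharP k p] (f : MvPowerSeries (Fin 3) k)
    {X B : Set (Spec (.of (MvPowerSeries (Fin 3) k)))} (hB : IsClosed B) (hBne : B ≠ Set.univ)
    {Z' : Scheme.{0}} {σ : Z' ⟶ Spec (.of (MvPowerSeries (Fin 3) k))} {X' B' : Set Z'}
    (hseq : IsBPermissibleSequenceB X B σ X' B') :
    WonAt f σ → WonAt f (𝟙 (Spec (.of (MvPowerSeries (Fin 3) k)))) := by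
  haveI : IsDomain (MvPowerSeries (Fin 3) k) := NoZeroDivisors.to_isDomain _
  haveI : IsNoetherianRing (MvPowerSeries (Fin 3) k) := isNoetherianRing_mvPowerSeries (Fin 3) (R := k)
  induction hseq with
  | refl => exact id
  | @blowup Z' Z'' σ X' B' h C τ hτ hreg hsub hBsing hperm hnc ih =>
    intro hW
    obtain ⟨hint, hnoeth, -, hB'c, hB'ne⟩ := forwardB hB hBne h
    haveI := hint
    haveI := hnoeth
    have hC : C ≠ ⊥ := centre_ne_bot_B C hsub hBsing (genericPoint_not_mem_of_isClosed hB'c hB'ne)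
    exact ih (wonAt_of_wonAt_blowup p hp f σ C τ hτ hreg hC hW)

/-- The corrected CJS input with the strict transform's origin made explicit: a corrected `𝓑`-permissible sequence
of `(V(f), Spec k⟦x⟧, ∅)` with snc boundary, `π⁻¹(V f) = X₁ ∪ B₁` and `X₁` transversal with `B₁`.
[OURS · folklore] -/
theorem exists_sequence_zeroLocusB (hCJS : CossartJannsenSaito2020EmbeddedSequenceB.{0})
    (f : MvPowerSeries (Fin 3) k) (hf : f ≠ 0) :
    ∃ (Z₁ : Scheme.{0}) (π : Z₁ ⟶ Spec (.of (MvPowerSeries (Fin 3) k))) (X₁ B₁ : Set Z₁),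
      IsBPermissibleSequenceB ((Spec (.of (MvPowerSeries (Fin 3) k))).zeroLocus (U := ⊤)
        {(Scheme.ΓSpecIso (.of (MvPowerSeries (Fin 3) k))).inv.hom f} : Set _) ∅ π X₁ B₁ ∧
      IsStrictNormalCrossingsDivisor Z₁ B₁ ∧
      π ⁻¹' ((Spec (.of (MvPowerSeries (Fin 3) k))).zeroLocus (U := ⊤)
        {(Scheme.ΓSpecIso (.of (MvPowerSeries (Fin 3) k))).inv.hom f} : Set _) = X₁ ∪ B₁ ∧
      IsTransversalWith Z₁ X₁ B₁ := by
  haveI : IsNoetherianRing (MvPowerSeries (Fin 3) k) := isNoetherianRing_mvPowerSeries (Fin 3) (R := k)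
  haveI : IsRegularLocalRing (MvPowerSeries (Fin 3) k) := isRegularLocalRing_mvPowerSeries k (Fin 3)
  haveI : IsRegularRing (MvPowerSeries (Fin 3) k) := isRegularRing_of_isRegularLocalRing _
  have hreg : Scheme.IsRegular (Spec (.of (MvPowerSeries (Fin 3) k))) := Scheme.isRegular_Spec (.of _)
  haveI : IsAdicComplete (maximalIdeal (MvPowerSeries (Fin 3) k)) (MvPowerSeries (Fin 3) k) := by
    rw [maximalIdeal_mvPowerSeries_eq_span]
    infer_instance
  have hexc : Scheme.IsExcellent (Spec (.of (MvPowerSeries (Fin 3) k))) :=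
    Scheme.isExcellent_Spec_of_isExcellentRing _ (isExcellentRing_of_isAdicComplete _)
  obtain ⟨Z₁, π, X₁, B₁, hseq, -, -, -, -, -, hB₁, htot, htr⟩ :=
    CossartJannsenSaito2020EmbeddedSequenceB.of_isClosed hCJS (Spec (.of (MvPowerSeries (Fin 3) k)))
      hreg hexc _ (isClosed_zeroLocus (k := k) f) (topologicalKrullDim_zeroLocus_le k f hf)
  exact ⟨Z₁, π, X₁, B₁, hseq, hB₁, htot, htr⟩

/-- **TRACK C (N = 3 milestone of the engine crux `LocalWeightedDrop`), CLOSED MODULO F-32bR.** The corrected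
`𝓑`-permissible embedded resolution SEQUENCE for reduced excellent surfaces
(`CossartJannsenSaito2020EmbeddedSequenceB`, universe `0`: Cossart–Jannsen–Saito 2020 Thm. 1.4 with the per-step clause
of Thm. 6.9 (a)) implies that every singular surface germ `f ∈ k⟦x₀,x₁,x₂⟧` over an algebraically closed field of prime
characteristic is won in the local weighted resolution game. Same conclusion as `surfaceGermsWon_of_CJSSequence`,
whose premise `CossartJannsenSaito2020EmbeddedSequence` is refutable as typed. (`IsAlgClosed` is not used by the proof;
kept to match the typed Track C target verbatim.) [OURS · L1 W4.3] -/
theorem surfaceGermsWon_of_CJSSequenceB (hCJS : CossartJannsenSaito2020EmbeddedSequenceB.{0}) :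
    ∀ (p : ℕ), p.Prime → ∀ (k : Type) [Field k] [CharP k p] [IsAlgClosed k] (f : MvPowerSeries (Fin 3) k),
      CobordantGame.IsSingular k f → CobordantGame.Won k 3 f := by
  intro p hp k _ _ _ f hf
  obtain ⟨Z₁, π, X₁, B₁, hseq, hB₁, htot, htr⟩ := exists_sequence_zeroLocusB (k := k) hCJS f hf.1
  have hX₁c : IsClosed X₁ := isClosed_of_seqB hseq (isClosed_zeroLocus (k := k) f)
  haveI : Nonempty (Spec (.of (MvPowerSeries (Fin 3) k))) := ⟨closedPoint (MvPowerSeries (Fin 3) k)⟩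
  have hB : IsClosed (∅ : Set (Spec (.of (MvPowerSeries (Fin 3) k)))) := isClosed_empty
  have hBne : (∅ : Set (Spec (.of (MvPowerSeries (Fin 3) k)))) ≠ Set.univ := Set.empty_ne_univ
  exact won_of_wonAt_id (k := k) f
    (wonAt_transformerB p hp f hB hBne hseq
      (wonAt_end f π X₁ B₁ hX₁c hB₁ htot htr (totalGerm_ne_zero_B hB hBne hseq hf.1))) hf

end Summit.ResolutionOfSingularities.ResolutionOfSingularities.Theorems.TrackC

end
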